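import Mathlib.RingTheory.MvPowerSeries.Expand
import Mathlib.Data.Finsupp.Weight
import Mathlib.Data.Finsupp.Antidiagonal
import HarnessLib

/-!
# Dwork's operator `Ψ = T_q ∘ G`: the matrix identity `Ψˢ = Ψ_{qˢ, G G_q ⋯ G_{q^{s-1}}}` (Koblitz V.3)

Part of the bottom-up proof of Dwork's rationality theorem
(`Literature/NumberTheory/LFunctions/DworkRationality.lean`), towards the named fact
`Dwork.dworkFredholmMatrix` (`…/DworkRationalityFredholm.lean`). Koblitz (GTM 58, Ch. V §3,
pp. 128–130) attaches to `G = ∑ g_w X^w` and `q ≥ 1` the operator `Ψ = Ψ_{q,G} = T_q ∘ G` on power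
series, `Ψ(X^u) = ∑_v g_{qv-u} X^v`, with matrix `A = (g_{qv-u})_{v,u}` ("`g_{qv-u} = 0` if `qv - u`
has a negative component"), and proves `Ψˢ = T_{qˢ} ∘ (G · G_q ⋯ G_{q^{s-1}}) = Ψ_{qˢ, G G_q ⋯ G_{q^{s-1}}}`
(p. 130), `G_q(X) = G(X^q)`. This file proves that identity at the level of matrix entries, for the
infinite matrix `A` over any commutative ring (each row of `A` has finite support, so its powers
are honest finite sums):

* `Literature.NumberTheory.LFunctions.Dwork.dworkEntry q G v u = g_{qv-u}` (`0` unless `u ≤ q v`);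
* `Literature.NumberTheory.LFunctions.Dwork.dworkPow q G s v u = (Aˢ)_{v,u}`, defined recursively
  by `(A^{s+1})_{v,u} = ∑_{a + w = qv} g_a (Aˢ)_{w,u}`;
* `Literature.NumberTheory.LFunctions.Dwork.dworkPow_eq`:
  `(Aˢ)_{v,u} = [X^{qˢv - u}] (∏_{l<s} G(X^{qˡ}))` (`0` unless `u ≤ qˢ v`), with `G(X^m)` Mathlib's
  `MvPowerSeries.expand m _ G`; in particular the diagonal entries are
  `(Aˢ)_{v,v} = [X^{(qˢ-1)v}] (G G_q ⋯ G_{q^{s-1}})` (`dworkPow_diag`), whose sum over `v` is Koblitz's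
  `Tr(Ψˢ)` (`Dwork.coeffTrace`).

## References

* N. Koblitz, *p-adic Numbers, p-adic Analysis, and Zeta-Functions*, 2nd ed., GTM 58 (1984),
  Ch. V §3, pp. 128–130. [Koblitz1984]
-/

open Finset MvPowerSeries

noncomputable section

namespace Literature.NumberTheory.LFunctions

namespace Dwork

variable {ι : Type*} {R : Type*} [CommRing R]

/-! ### The matrix of `Ψ_{q,G}` and its powers -/

section Defs

open Classical in
/-- The entry `A_{v,u} = g_{qv-u}` of the matrix of Dwork's operator `Ψ_{q,G} = T_q ∘ G` in the
monomial basis (`Ψ(X^u) = ∑_v g_{qv-u} X^v`; Koblitz, Ch. V §3, p. 129, with `g_{qv-u} = 0` if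
`qv - u ∉ U`). [cite: Koblitz1984, Ch. V §3] -/
def dworkEntry (q : ℕ) (G : MvPowerSeries ι R) (v u : ι →₀ ℕ) : R :=
  if u ≤ q • v then coeff (q • v - u) G else 0

open Classical in
/-- The entries `(Aˢ)_{v,u}` of the powers of the matrix of `Ψ_{q,G}`: `(A⁰)_{v,u} = δ_{v,u}` and
`(A^{s+1})_{v,u} = ∑_w A_{v,w} (Aˢ)_{w,u} = ∑_{a + w = qv} g_a (Aˢ)_{w,u}` (a finite sum: the row `v`
of `A` is supported on `w ≤ qv`). [cite: Koblitz1984, Ch. V §3] -/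
def dworkPow (q : ℕ) (G : MvPowerSeries ι R) : ℕ → (ι →₀ ℕ) → (ι →₀ ℕ) → R
  | 0, v, u => if v = u then 1 else 0
  | s + 1, v, u => ∑ x ∈ antidiagonal (q • v), coeff x.1 G * dworkPow q G s x.2 u

open Classical in
/-- `(A⁰)_{v,u} = δ_{v,u}`. [folklore] -/
@[simp] theorem dworkPow_zero (q : ℕ) (G : MvPowerSeries ι R) (v u : ι →₀ ℕ) :
    dworkPow q G 0 v u = if v = u then 1 else 0 := rfl

open Classical in
/-- `(A^{s+1})_{v,u} = ∑_{a + w = qv} g_a (Aˢ)_{w,u}`. [folklore] -/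
theorem dworkPow_succ (q : ℕ) (G : MvPowerSeries ι R) (s : ℕ) (v u : ι →₀ ℕ) :
    dworkPow q G (s + 1) v u =
      ∑ x ∈ antidiagonal (q • v), coeff x.1 G * dworkPow q G s x.2 u := rfl

open Classical in
/-- `(A¹)_{v,u} = A_{v,u} = g_{qv-u}`. [cite: Koblitz1984, Ch. V §3] -/
theorem dworkPow_one (q : ℕ) (G : MvPowerSeries ι R) (v u : ι →₀ ℕ) :
    dworkPow q G 1 v u = dworkEntry q G v u := by
  rw [dworkPow_succ, dworkEntry]
  simp only [dworkPow_zero, mul_ite, mul_one, mul_zero]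
  rw [Finset.sum_ite, Finset.sum_const_zero, add_zero]
  split_ifs with h
  · rw [Finset.sum_eq_single (q • v - u, u)]
    · intro x hx hne
      rw [mem_filter, mem_antidiagonal] at hx
      exfalso; apply hne
      have h2 : x.2 = u := hx.2
      have h1 : x.1 = q • v - u := by
        rw [← hx.1, h2, add_tsub_cancel_right]
      exact Prod.ext h1 h2
    · intro hnot
      exfalso; apply hnot
      rw [mem_filter, mem_antidiagonal]
      exact ⟨tsub_add_cancel_of_le h, rfl⟩
  · apply Finset.sum_eq_zero
    intro x hx
    rw [mem_filter, mem_antidiagonal] at hx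
    exfalso; apply h
    rw [← hx.1, hx.2]
    exact le_add_self

end Defs

/-! ### `Ψˢ = Ψ_{qˢ, G G_q ⋯ G_{q^{s-1}}}` -/

section Pow

/-- Cancelling a positive scalar in an inequality of exponent vectors. [folklore] -/
theorem le_of_smul_le_smul {q : ℕ} (hq : 0 < q) {a v : ι →₀ ℕ} (h : q • a ≤ q • v) : a ≤ v := by
  intro i
  have := h i
  simp only [Finsupp.smul_apply, smul_eq_mul] at this
  exact Nat.le_of_mul_le_mul_left this hq

/-- `q • (v - a) = q • v - q • a` for exponent vectors (pointwise `Nat.mul_sub`). [folklore] -/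
theorem smul_tsub (q : ℕ) (v a : ι →₀ ℕ) : q • (v - a) = q • v - q • a := by
  ext i
  simp only [Finsupp.smul_apply, smul_eq_mul, Finsupp.tsub_apply, Nat.mul_sub]

open Classical in
/-- **`Ψˢ = Ψ_{qˢ, G G_q ⋯ G_{q^{s-1}}}`** at the level of matrix entries (Koblitz, Ch. V §3,
p. 130, the chain of equalities `Ψˢ = T_q ∘ G ∘ T_q ∘ G ∘ Ψ^{s-2} = ⋯ = Ψ_{qˢ, G·G_q⋯G_{q^{s-1}}}`;
here by induction on `s` from `Ψ_{q,G} ∘ Ψ_{Q,H} = Ψ_{qQ, G_Q · H}`): for `q ≥ 1`,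
`(Aˢ)_{v,u} = [X^{qˢ v - u}] (∏_{l<s} G(X^{qˡ}))` if `u ≤ qˢ v`, and `0` otherwise. [cite: Koblitz1984, Ch. V §3] -/
theorem dworkPow_eq {q : ℕ} (hq : q ≠ 0) (G : MvPowerSeries ι R) (s : ℕ) (v u : ι →₀ ℕ) :
    dworkPow q G s v u =
      dworkEntry (q ^ s) (∏ l ∈ range s, expand (q ^ l) (pow_ne_zero l hq) G) v u := by
  induction s generalizing v u with
  | zero =>
    rw [dworkPow_zero, dworkEntry, prod_range_zero, pow_zero, one_smul]
    by_cases h : v = u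
    · subst h
      rw [if_pos rfl, if_pos le_rfl, tsub_self, MvPowerSeries.coeff_zero_one]
    · rw [if_neg h]
      split_ifs with hle
      · rw [MvPowerSeries.coeff_one, if_neg]
        intro h0
        exact h (le_antisymm (tsub_eq_zero_iff_le.mp h0) hle)
      · rfl
  | succ s ih =>
    rw [dworkPow_succ]
    simp_rw [ih]
    set H : MvPowerSeries ι R := ∏ l ∈ range s, expand (q ^ l) (pow_ne_zero l hq) G with hH
    rw [prod_range_succ, ← hH, dworkEntry]
    have hqs : 0 < q ^ s := pow_pos (Nat.pos_of_ne_zero hq) s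
    have hT : q ^ (s + 1) • v = q ^ s • (q • v) := by rw [pow_succ, mul_smul]
    by_cases hle : u ≤ q ^ (s + 1) • v
    · rw [if_pos hle, coeff_mul]
      -- both sums run over the same non-zero terms: `(a, w) ↦ (qˢ w - u, qˢ a)`
      refine Finset.sum_bij_ne_zero (fun x _ _ => (q ^ s • x.2 - u, q ^ s • x.1)) ?_ ?_ ?_ ?_
      · intro x hx hfx
        rw [mem_antidiagonal] at hx ⊢
        have hux : u ≤ q ^ s • x.2 := by
          by_contra hnot
          exact hfx (by rw [dworkEntry, if_neg hnot, mul_zero])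
        change q ^ s • x.2 - u + q ^ s • x.1 = q ^ (s + 1) • v - u
        rw [tsub_add_eq_add_tsub hux, ← smul_add, add_comm x.2 x.1, hx, ← hT]
      · intro x hx _ y hy _ hxy
        rw [mem_antidiagonal] at hx hy
        obtain ⟨-, h2⟩ := Prod.mk.inj hxy
        have h3 : x.1 = y.1 := nsmul_right_injective (pow_ne_zero s hq) h2
        have h4 : x.2 = y.2 := by
          have := hx.trans hy.symm
          rw [h3] at this
          exact add_left_cancel this
        exact Prod.ext h3 h4
      · intro cd hcd hg
        rw [mem_antidiagonal] at hcd
        have hE : coeff cd.2 (expand (q ^ s) (pow_ne_zero s hq) G) ≠ 0 := fun h0 =>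
          hg (by rw [h0, mul_zero])
        obtain ⟨a, -, ha⟩ := support_expand_subset (q ^ s) (pow_ne_zero s hq) G hE
        change q ^ s • a = cd.2 at ha
        have hdT : cd.2 + u ≤ q ^ (s + 1) • v :=
          calc cd.2 + u ≤ (cd.1 + cd.2) + u := by gcongr; exact le_add_self
            _ = q ^ (s + 1) • v := by rw [hcd, tsub_add_cancel_of_le hle]
        have haqv : a ≤ q • v := by
          apply le_of_smul_le_smul hqs
          rw [ha, ← hT]
          exact le_trans le_self_add hdT
        have hw : q ^ s • (q • v - a) = q ^ (s + 1) • v - cd.2 := by rw [smul_tsub, ← hT, ha]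
        have hux : u ≤ q ^ s • (q • v - a) := by
          rw [hw]
          exact le_tsub_of_add_le_left hdT
        have hc1 : q ^ s • (q • v - a) - u = cd.1 := by
          rw [hw, eq_tsub_of_add_eq hcd, tsub_tsub, tsub_tsub, add_comm cd.2 u]
        have hfg : coeff a G * dworkEntry (q ^ s) H (q • v - a) u = coeff cd.1 H * coeff cd.2
            (expand (q ^ s) (pow_ne_zero s hq) G) := by
          rw [dworkEntry, if_pos hux, hc1, ← ha, coeff_expand_smul, mul_comm]
        refine ⟨(a, q • v - a), ?_, ?_, ?_⟩
        · rw [mem_antidiagonal]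
          exact add_tsub_cancel_of_le haqv
        · change coeff a G * dworkEntry (q ^ s) H (q • v - a) u ≠ 0
          rw [hfg]
          exact hg
        · exact Prod.ext hc1 ha
      · intro x hx hfx
        have hux : u ≤ q ^ s • x.2 := by
          by_contra hnot
          exact hfx (by rw [dworkEntry, if_neg hnot, mul_zero])
        change coeff x.1 G * dworkEntry (q ^ s) H x.2 u =
          coeff (q ^ s • x.2 - u) H * coeff (q ^ s • x.1) (expand (q ^ s) (pow_ne_zero s hq) G)
        rw [dworkEntry, if_pos hux, coeff_expand_smul, mul_comm]
    · rw [if_neg hle]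
      apply Finset.sum_eq_zero
      intro x hx
      rw [mem_antidiagonal] at hx
      rw [dworkEntry, if_neg, mul_zero]
      intro hu
      apply hle
      refine hu.trans ?_
      rw [hT, ← hx, smul_add]
      exact le_add_self

open Classical in
/-- **The diagonal entries** `(Aˢ)_{v,v} = [X^{(qˢ-1)v}] (G G_q ⋯ G_{q^{s-1}})` (Koblitz, Ch. V §3,
p. 129: "`Tr Ψ = ∑_{u ∈ U} g_{(q-1)u}`", applied to `Ψˢ = Ψ_{qˢ, G G_q ⋯ G_{q^{s-1}}}`). [cite: Koblitz1984, Ch. V §3 Lemma 3] -/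
theorem dworkPow_diag {q : ℕ} (hq : q ≠ 0) (G : MvPowerSeries ι R) (s : ℕ) (v : ι →₀ ℕ) :
    dworkPow q G s v v =
      coeff ((q ^ s - 1) • v) (∏ l ∈ range s, expand (q ^ l) (pow_ne_zero l hq) G) := by
  have h1 : 1 ≤ q ^ s := Nat.one_le_pow _ _ (Nat.pos_of_ne_zero hq)
  have hv : v ≤ q ^ s • v := fun i => by
    rw [Finsupp.smul_apply, smul_eq_mul]
    exact Nat.le_mul_of_pos_left _ h1
  have hsub : q ^ s • v - v = (q ^ s - 1) • v := by
    apply tsub_eq_of_eq_add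
    rw [← succ_nsmul, Nat.sub_add_cancel h1]
  rw [dworkPow_eq hq, dworkEntry, if_pos hv, hsub]

end Pow

end Dwork

end Literature.NumberTheory.LFunctions
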